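import Summits.QuantumFields.YangMills.Theorems.BalabanUVNodesN19CoreTVInvariantBlocks
import Summits.QuantumFields.YangMills.Theorems.BalabanUVNodesN19CoreProductBlockFamily
import Mathlib.Probability.Kernel.Composition.MeasureComp
import Mathlib.Probability.Kernel.Composition.MeasureCompProd

/-!
# BalabanUVNodes ∕ N19 — THE TV CURRENCY ALONG DISINTEGRATIONS AND KERNEL CHAINS, ONE CLASS: base and fibre radii compose `1 − (1 − ρ₁)(1 − ρ₂)` (SHARP),
# a chain of Markov steps composes `1 − (1 − ρ₀)∏(1 − σ_k) ≤ ρ₀ + Σ σ_k`, and COMMON steps are FREE (data processing) — no transport factor in this currency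

Cell `pub-ymgap` (HUMAN RULING D-0062 Track A ∕ D-0149 width seats), WIDTH SEAT `pub-ymgap-dag-n19-w2` (node n19 = NE7, seat 2 of 3), generation g4,
CLAIM-2 ∕ INTENT-3.  Route `Summits/QuantumFields/YangMills/Theses/BalabanUVNodes.lean`, key item K3⁷ `SpineGivenEndpointR13SepCoPH` (stmt-QuantumFields-20544); filed
`--kind proof --supports … --as helper`.  COUNT-NEUTRAL.  THEOREMS ONLY (0 `def`, 0 `sorry`); imports this seat's g4 `…N19CoreTVInvariantBlocks` (file 2: `twoPoint_toy`; through it file 1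
`…N19TVProductBlocks` p606070: the capped-majorant road, `integrable_of_unit_range`, `abs_real_sub_real_le_one`, `radius_nonneg_of_tv`, and n19-c's
`abs_integral_sub_integral_le_of_tv`), g2
`…N19CoreProductBlockFamily` (p594080: `one_sub_prod_one_sub_le_sum`) and Mathlib's Giry ∕ kernel composition (`Measure.bind_apply`, `Measure.compProd_apply`, `Kernel.measurable_coe`);
edits nothing, re-declares nothing.

WHY.  File 1 (`…N19TVProductBlocks`) did INDEPENDENT blocks (`μ ⊗ ν`), the class-level companion of g2's `core_prod`.  The other two compositions g2 typed at the term level are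
the SKEW ∕ FIBRED product (`core_sigma`: a base block and a fibre family read along the base, constants costing their oscillation) and the SCALE CHAIN (`…N19CoreScaleChain`:
K-dependent families of matched factors).  Their class-level companions in n19-c's TV_cl currency are the DISINTEGRATION `p ⊗ₘ κ` (base law, fibre kernel) and the CHAIN
`μ_{k+1} = κ_k ∘ₘ μ_k` of Markov steps — typed here, with the one fact that has no term-level analogue: a Markov step COMMON to both runs costs NOTHING (TV is non-expansive), so
along a chain of common steps with per-step injected discrepancies `σ_k` the two runs' laws stay `(ρ₀ + Σ_k σ_k)`-close with NO transport ∕ contraction factor — contrast node U4's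
`T4CauchySum.delta E ρ inj K = E·Σ_{j+n=K} inj K j·ρⁿ`, where the log-ratio currency needs the irrelevance contraction `ρⁿ` against its `(K+1)^c` Lipschitz growth.

WHAT IS PROVED ([folklore] measure theory; «TV» = closeness on every measurable SET, reference-measure-free; kernels are Mathlib `ProbabilityTheory.Kernel`, Markov).
* §1 ONE MARKOV STEP `κ ∘ₘ p` (Mathlib `Measure.bind`): `comp_real_eq_integral` (`(κ ∘ₘ p)(S) = ∫ κ_x(S) dp(x)` in real letters) · ★★ `abs_comp_real_sub_comp_real_le_of_tv` (base laws
  `ρ₁`-close, kernels FIBREWISE `ρ₂`-close, `ρ₂ ∈ [0, 1]` ⇒ the image laws are `(ρ₁ + ρ₂ − ρ₁ρ₂)`-close — file 1's capped-majorant road verbatim on `f(x) = κ_x(S)`) ·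
  ★★ `abs_comp_real_sub_comp_real_le_base` (DATA PROCESSING: the SAME kernel in both runs ⇒ `≤ ρ₁` — a common step is free) · ★ `abs_comp_real_sub_comp_real_le_integral_fibre`
  (the SAME base law, x-DEPENDENT fibre radii `ρ₂(x)` ⇒ `≤ ∫ ρ₂ dp`: fibre discrepancies are paid by their MEAN under the base law, not their supremum — the TV face of dag-n19-w1's
  averaging gain `…N19FibreAveragingGain`) · `abs_comp_real_sub_comp_real_le_add_of_tv` (`ρ₁ + ρ₂`, no range condition).
* §2 DISINTEGRATIONS `p ⊗ₘ κ` (Mathlib `Measure.compProd`, the joint law on `X × Y`; skew product): `compProd_real_eq_integral_sectionReal` · ★★ `abs_compProd_real_sub_le_of_tv`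
  (`ρ₁ + ρ₂ − ρ₁ρ₂`; file 1's `abs_prod_real_sub_prod_real_le_of_tv` is the constant-kernel case, `Measure.compProd_const`) · `abs_compProd_real_sub_le_base` (same kernel: `≤ ρ₁`).
* §3 CHAINS (scale chains): laws `μ_k`, `μ′_k` on spaces `Ω k` driven by Markov steps `μ_{k+1} = κ_k ∘ₘ μ_k`, `μ′_{k+1} = κ′_k ∘ₘ μ′_k` (the recursion is a HYPOTHESIS on user-supplied
  sequences — no `def`), initial radius `ρ₀`, per-step fibrewise radii `σ_k ∈ [0, 1]`: ★★ `abs_chain_real_sub_le_prod` (`≤ 1 − (1 − ρ₀)·∏_{k<n}(1 − σ_k)`, induction on §1) ·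
  ★ `abs_chain_real_sub_le_sum` (`≤ ρ₀ + Σ_{k<n} σ_k`, g2's `one_sub_prod_one_sub_le_sum`) · ★★ `abs_chain_real_sub_le_initial` (COMMON steps: `≤ ρ₀` for every `n` — discrepancies are
  never amplified) · `abs_chain_real_sub_le_tsum` (summable injections: `≤ ρ₀ + Σ_k σ_k` uniformly in `n`).
* §4 ★ SHARPNESS of §1 `tv_comp_sharp_toy`: on `Bool`, `p = δ_false`, `p′ = (1 − ρ₁)δ_false + ρ₁δ_true`, `κ = Kernel.id`-like deterministic copy, `κ′` = «from `false` jump to `true` with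
  probability `ρ₂`, stay at `true`»: the image gap at `{true}` EQUALS `ρ₁ + ρ₂ − ρ₁ρ₂`.
READING (located, for the N19′ ∕ N14 lanes; nothing proposed).  In the TV_cl currency the THREE composition rules of node U5's data are now typed at the class level with the same
law as the bad weights: independent blocks (file 1), disintegrations (§2), chains (§3) all compose `1 − ∏(1 − ρ)`; and the chain rule carries NO transport factor.  HONEST LIMIT: this is
a PER-CLASS tool exactly like n19-c's TV_cl — the GLOBAL total variation of two lattice Gibbs laws degenerates with the volume (per-site discrepancy `η` on `N` sites reads `≈ 1 − e^{−cNη²}`),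
so nothing here is a currency for whole-torus laws; and the runs' R-steps of [Balaban1989LargeFieldI] (0.4) are NOT instantiated as kernels here (hypothesis shapes only).

HONEST FRAMING.  [folklore] measure theory on hypothesis SHAPES produced by nobody; ZERO Bałaban content; NE7 ∕ NE1′ NOT PRINTED as two-run statements for d = 4 and NOT proved;
N14 ∕ N19 NOT discharged; K3⁷ OPEN, not claimed; counts UNMOVED (typed 28∕28 · discharged 5∕27 · A 5∕28); no count claim.  One finite four-torus programme at fixed `ε`; R4 closes
the conditional finite-𝕋⁴ rung `BalabanLadder.UV` only — NOT ℝ⁴, NOT OS, NOT the Yang–Mills mass gap, NOT Clay.  0 `def`; 0 `sorry`; standard axioms.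
-/

set_option autoImplicit false

noncomputable section

open MeasureTheory ProbabilityTheory
open scoped ENNReal

namespace Summit.QuantumFields.YangMills.BalabanUVNodes.N19TVKernelChain

open Summit.QuantumFields.YangMills.BalabanUVNodes.N19TVCurrency (abs_integral_sub_integral_le_of_tv)
open Summit.QuantumFields.YangMills.BalabanUVNodes.N19TVProductBlocks
open Summit.QuantumFields.YangMills.BalabanUVNodes.N19CoreTVInvariantBlocks (twoPoint_toy)
open Summit.QuantumFields.YangMills.BalabanUVNodes.N19CoreProductBlockFamily (one_sub_prod_one_sub_le_sum)

/-! ## §1 One Markov step `κ ∘ₘ p` [folklore] -/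

section Step

variable {X Y : Type*} [MeasurableSpace X] [MeasurableSpace Y]
  {p p' : Measure X} [IsProbabilityMeasure p] [IsProbabilityMeasure p'] {κ κ' : Kernel X Y} [IsMarkovKernel κ] [IsMarkovKernel κ']
  {ρ₁ ρ₂ : ℝ}

/-- The fibre function `x ↦ κ_x(S)` of a Markov kernel is measurable with values in `[0, 1]` (real letters). [folklore] -/
theorem measurable_kernelReal (κ : Kernel X Y) {S : Set Y} (hS : MeasurableSet S) : Measurable fun x => (κ x).real S :=
  (κ.measurable_coe hS).ennreal_toReal

/-- **THE IMAGE LAW OF A SET IS THE INTEGRAL OF THE FIBRE MASSES, IN REAL LETTERS**: `(κ ∘ₘ p)(S) = ∫ κ_x(S) dp(x)` (Mathlib `Measure.bind_apply`, `integral_toReal`). [folklore] -/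
theorem comp_real_eq_integral (p : Measure X) (κ : Kernel X Y) [IsMarkovKernel κ] {S : Set Y} (hS : MeasurableSet S) :
    (κ ∘ₘ p).real S = ∫ x, (κ x).real S ∂p := by
  simp only [measureReal_def]
  rw [Measure.bind_apply hS κ.measurable.aemeasurable,
    integral_toReal (κ.measurable_coe hS).aemeasurable (ae_of_all _ fun x => measure_lt_top _ _)]

/-- One-sided step bound (file 1's capped-majorant road on the fibre functions). [folklore] -/
theorem comp_real_sub_comp_real_le_of_tv (hρ₂ : 0 ≤ ρ₂) (hρ₂1 : ρ₂ ≤ 1)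
    (h₁ : ∀ S : Set X, MeasurableSet S → |p'.real S - p.real S| ≤ ρ₁)
    (h₂ : ∀ x, ∀ S : Set Y, MeasurableSet S → |(κ' x).real S - (κ x).real S| ≤ ρ₂) {S : Set Y} (hS : MeasurableSet S) :
    (κ' ∘ₘ p').real S - (κ ∘ₘ p).real S ≤ ρ₁ + ρ₂ - ρ₁ * ρ₂ := by
  set f : X → ℝ := fun x => (κ x).real S with hf
  set f' : X → ℝ := fun x => (κ' x).real S with hf'
  set g : X → ℝ := fun x => min (f x + ρ₂) 1 with hg
  have hfm : Measurable f := measurable_kernelReal κ hS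
  have hf'm : Measurable f' := measurable_kernelReal κ' hS
  have hgm : Measurable g := (hfm.add_const ρ₂).min measurable_const
  have hf0 : ∀ x, 0 ≤ f x := fun x => measureReal_nonneg
  have hf1 : ∀ x, f x ≤ 1 := fun x => measureReal_le_one
  have hf'0 : ∀ x, 0 ≤ f' x := fun x => measureReal_nonneg
  have hf'1 : ∀ x, f' x ≤ 1 := fun x => measureReal_le_one
  have hf'g : ∀ x, f' x ≤ g x := fun x => le_min (by have h := (abs_le.1 (h₂ x S hS)).2; linarith) (hf'1 x)
  have hglo : ∀ x, ρ₂ ≤ g x := fun x => le_min (by linarith [hf0 x]) hρ₂1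
  have hg0 : ∀ x, 0 ≤ g x := fun x => hρ₂.trans (hglo x)
  have hghi : ∀ x, g x ≤ 1 := fun x => min_le_right _ _
  have hgf : ∀ x, g x ≤ f x + ρ₂ := fun x => min_le_left _ _
  rw [comp_real_eq_integral p' κ' hS, comp_real_eq_integral p κ hS]
  have step1 : ∫ x, f' x ∂p' ≤ ∫ x, g x ∂p' :=
    integral_mono (integrable_of_unit_range p' hf'm hf'0 hf'1) (integrable_of_unit_range p' hgm hg0 hghi) hf'g
  have step2 : |∫ x, g x ∂p' - ∫ x, g x ∂p| ≤ (1 - ρ₂) * ρ₁ := abs_integral_sub_integral_le_of_tv hgm hglo hghi hρ₂1 h₁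
  have step3 : ∫ x, g x ∂p ≤ ∫ x, f x ∂p + ρ₂ := by
    calc ∫ x, g x ∂p ≤ ∫ x, (f x + ρ₂) ∂p :=
          integral_mono (integrable_of_unit_range p hgm hg0 hghi) ((integrable_of_unit_range p hfm hf0 hf1).add (integrable_const _)) hgf
      _ = ∫ x, f x ∂p + ρ₂ := by
          rw [integral_add (integrable_of_unit_range p hfm hf0 hf1) (integrable_const _), integral_const, smul_eq_mul,
            probReal_univ, one_mul]
  have step2' := (abs_le.1 step2).2
  have hring : (1 - ρ₂) * ρ₁ + ρ₂ = ρ₁ + ρ₂ - ρ₁ * ρ₂ := by ring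
  linarith

/-- ★★ **ONE MARKOV STEP: BASE AND FIBRE RADII COMPOSE LIKE BAD WEIGHTS.**  Base laws `p, p′` `ρ₁`-close on every set; Markov kernels `κ, κ′` FIBREWISE `ρ₂`-close on every set
(`0 ≤ ρ₂ ≤ 1`) ⇒ the image laws `κ ∘ₘ p`, `κ′ ∘ₘ p′` are `(ρ₁ + ρ₂ − ρ₁ρ₂) = 1 − (1 − ρ₁)(1 − ρ₂)`-close on every set.  SHARP (§4). [folklore] -/
theorem abs_comp_real_sub_comp_real_le_of_tv (hρ₂ : 0 ≤ ρ₂) (hρ₂1 : ρ₂ ≤ 1)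
    (h₁ : ∀ S : Set X, MeasurableSet S → |p'.real S - p.real S| ≤ ρ₁)
    (h₂ : ∀ x, ∀ S : Set Y, MeasurableSet S → |(κ' x).real S - (κ x).real S| ≤ ρ₂) {S : Set Y} (hS : MeasurableSet S) :
    |(κ' ∘ₘ p').real S - (κ ∘ₘ p).real S| ≤ ρ₁ + ρ₂ - ρ₁ * ρ₂ :=
  abs_sub_le_iff.2
    ⟨comp_real_sub_comp_real_le_of_tv hρ₂ hρ₂1 h₁ h₂ hS,
      comp_real_sub_comp_real_le_of_tv hρ₂ hρ₂1 (fun S hS => by rw [abs_sub_comm]; exact h₁ S hS)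
        (fun x S hS => by rw [abs_sub_comm]; exact h₂ x S hS) hS⟩

/-- ★★ **DATA PROCESSING — A COMMON STEP IS FREE.**  The SAME Markov kernel applied to two `ρ₁`-close laws yields `ρ₁`-close laws: in the TV currency a step common to both runs
never amplifies their discrepancy (no Lipschitz ∕ transport factor). [folklore] -/
theorem abs_comp_real_sub_comp_real_le_base (h₁ : ∀ S : Set X, MeasurableSet S → |p'.real S - p.real S| ≤ ρ₁) {S : Set Y} (hS : MeasurableSet S) :
    |(κ ∘ₘ p').real S - (κ ∘ₘ p).real S| ≤ ρ₁ := by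
  have h := abs_comp_real_sub_comp_real_le_of_tv (κ := κ) (κ' := κ) (ρ₂ := 0) le_rfl zero_le_one h₁
    (fun x S _ => by rw [sub_self, abs_zero]) hS
  simpa using h

/-- ★ **FIBRE DISCREPANCIES ARE PAID BY THEIR MEAN** (the TV face of dag-n19-w1's averaging gain): the SAME base law pushed through two Markov kernels whose fibres are
`ρ₂(x)`-close on every set, `ρ₂` integrable ⇒ the image laws are `(∫ ρ₂ dp)`-close on every set — the supremum of the fibre radii is never needed. [folklore] -/
theorem abs_comp_real_sub_comp_real_le_integral_fibre {ρ : X → ℝ} (hρi : Integrable ρ p)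
    (h₂ : ∀ x, ∀ S : Set Y, MeasurableSet S → |(κ' x).real S - (κ x).real S| ≤ ρ x) {S : Set Y} (hS : MeasurableSet S) :
    |(κ' ∘ₘ p).real S - (κ ∘ₘ p).real S| ≤ ∫ x, ρ x ∂p := by
  have hfm : Measurable fun x => (κ x).real S := measurable_kernelReal κ hS
  have hf'm : Measurable fun x => (κ' x).real S := measurable_kernelReal κ' hS
  rw [comp_real_eq_integral p κ' hS, comp_real_eq_integral p κ hS,
    ← integral_sub (integrable_of_unit_range p hf'm (fun x => measureReal_nonneg) fun x => measureReal_le_one)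
      (integrable_of_unit_range p hfm (fun x => measureReal_nonneg) fun x => measureReal_le_one)]
  calc |∫ x, ((κ' x).real S - (κ x).real S) ∂p| = ‖∫ x, ((κ' x).real S - (κ x).real S) ∂p‖ := (Real.norm_eq_abs _).symm
    _ ≤ ∫ x, ρ x ∂p := norm_integral_le_of_norm_le hρi (ae_of_all _ fun x => by rw [Real.norm_eq_abs]; exact h₂ x S hS)

/-- **THE SUB-ADDITIVE STEP BOUND, NO RANGE CONDITION**: `ρ₁ + ρ₂` (cap `ρ₂` at `1`, apply the sharp bound, drop the cross term). [folklore] -/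
theorem abs_comp_real_sub_comp_real_le_add_of_tv (h₁ : ∀ S : Set X, MeasurableSet S → |p'.real S - p.real S| ≤ ρ₁)
    (h₂ : ∀ x, ∀ S : Set Y, MeasurableSet S → |(κ' x).real S - (κ x).real S| ≤ ρ₂) {S : Set Y} (hS : MeasurableSet S) :
    |(κ' ∘ₘ p').real S - (κ ∘ₘ p).real S| ≤ ρ₁ + ρ₂ := by
  have hρ₁ : 0 ≤ ρ₁ := radius_nonneg_of_tv h₁
  obtain ⟨x₀, -⟩ : (Set.univ : Set X).Nonempty := nonempty_of_measure_ne_zero (by rw [measure_univ (μ := p)]; exact one_ne_zero)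
  have hρ₂ : 0 ≤ ρ₂ := (abs_nonneg _).trans (h₂ x₀ ∅ MeasurableSet.empty)
  have hm0 : 0 ≤ min ρ₂ 1 := le_min hρ₂ zero_le_one
  have h₂c : ∀ x, ∀ S : Set Y, MeasurableSet S → |(κ' x).real S - (κ x).real S| ≤ min ρ₂ 1 := fun x S hS =>
    le_min (h₂ x S hS) (abs_real_sub_real_le_one (κ x) (κ' x) S)
  calc |(κ' ∘ₘ p').real S - (κ ∘ₘ p).real S| ≤ ρ₁ + min ρ₂ 1 - ρ₁ * min ρ₂ 1 :=
        abs_comp_real_sub_comp_real_le_of_tv hm0 (min_le_right _ _) h₁ h₂c hS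
    _ ≤ ρ₁ + ρ₂ := by nlinarith [min_le_left ρ₂ 1, mul_nonneg hρ₁ hm0]

end Step

/-! ## §2 Disintegrations `p ⊗ₘ κ` (skew products) [folklore] -/

section Disintegration

variable {X Y : Type*} [MeasurableSpace X] [MeasurableSpace Y]
  {p p' : Measure X} [IsProbabilityMeasure p] [IsProbabilityMeasure p'] {κ κ' : Kernel X Y} [IsMarkovKernel κ] [IsMarkovKernel κ']
  {ρ₁ ρ₂ : ℝ}

/-- The section function `x ↦ κ_x(S_x)` of a measurable `S ⊆ X × Y` along a Markov kernel is measurable (real letters). [folklore] -/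
theorem measurable_kernelSectionReal (κ : Kernel X Y) [IsSFiniteKernel κ] {S : Set (X × Y)} (hS : MeasurableSet S) :
    Measurable fun x => (κ x).real (Prod.mk x ⁻¹' S) :=
  (Kernel.measurable_kernel_prodMk_left hS).ennreal_toReal

/-- **THE JOINT LAW OF A SET IS THE INTEGRAL OF ITS KERNEL SECTIONS, IN REAL LETTERS**: `(p ⊗ₘ κ)(S) = ∫ κ_x(S_x) dp(x)` (Mathlib `Measure.compProd_apply`). [folklore] -/
theorem compProd_real_eq_integral_sectionReal (p : Measure X) [SFinite p] (κ : Kernel X Y) [IsMarkovKernel κ] {S : Set (X × Y)}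
    (hS : MeasurableSet S) : (p ⊗ₘ κ).real S = ∫ x, (κ x).real (Prod.mk x ⁻¹' S) ∂p := by
  simp only [measureReal_def]
  rw [Measure.compProd_apply hS,
    integral_toReal (Kernel.measurable_kernel_prodMk_left hS).aemeasurable (ae_of_all _ fun x => measure_lt_top _ _)]

/-- One-sided disintegration bound (capped-majorant road on the kernel sections). [folklore] -/
theorem compProd_real_sub_le_of_tv (hρ₂ : 0 ≤ ρ₂) (hρ₂1 : ρ₂ ≤ 1)
    (h₁ : ∀ S : Set X, MeasurableSet S → |p'.real S - p.real S| ≤ ρ₁)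
    (h₂ : ∀ x, ∀ S : Set Y, MeasurableSet S → |(κ' x).real S - (κ x).real S| ≤ ρ₂) {S : Set (X × Y)} (hS : MeasurableSet S) :
    (p' ⊗ₘ κ').real S - (p ⊗ₘ κ).real S ≤ ρ₁ + ρ₂ - ρ₁ * ρ₂ := by
  set f : X → ℝ := fun x => (κ x).real (Prod.mk x ⁻¹' S) with hf
  set f' : X → ℝ := fun x => (κ' x).real (Prod.mk x ⁻¹' S) with hf'
  set g : X → ℝ := fun x => min (f x + ρ₂) 1 with hg
  have hfm : Measurable f := measurable_kernelSectionReal κ hS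
  have hf'm : Measurable f' := measurable_kernelSectionReal κ' hS
  have hgm : Measurable g := (hfm.add_const ρ₂).min measurable_const
  have hf0 : ∀ x, 0 ≤ f x := fun x => measureReal_nonneg
  have hf1 : ∀ x, f x ≤ 1 := fun x => measureReal_le_one
  have hf'0 : ∀ x, 0 ≤ f' x := fun x => measureReal_nonneg
  have hf'1 : ∀ x, f' x ≤ 1 := fun x => measureReal_le_one
  have hf'g : ∀ x, f' x ≤ g x := fun x =>
    le_min (by have h := (abs_le.1 (h₂ x (Prod.mk x ⁻¹' S) (hS.preimage measurable_prodMk_left))).2; linarith) (hf'1 x)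
  have hglo : ∀ x, ρ₂ ≤ g x := fun x => le_min (by linarith [hf0 x]) hρ₂1
  have hg0 : ∀ x, 0 ≤ g x := fun x => hρ₂.trans (hglo x)
  have hghi : ∀ x, g x ≤ 1 := fun x => min_le_right _ _
  have hgf : ∀ x, g x ≤ f x + ρ₂ := fun x => min_le_left _ _
  rw [compProd_real_eq_integral_sectionReal p' κ' hS, compProd_real_eq_integral_sectionReal p κ hS]
  have step1 : ∫ x, f' x ∂p' ≤ ∫ x, g x ∂p' :=
    integral_mono (integrable_of_unit_range p' hf'm hf'0 hf'1) (integrable_of_unit_range p' hgm hg0 hghi) hf'g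
  have step2 : |∫ x, g x ∂p' - ∫ x, g x ∂p| ≤ (1 - ρ₂) * ρ₁ := abs_integral_sub_integral_le_of_tv hgm hglo hghi hρ₂1 h₁
  have step3 : ∫ x, g x ∂p ≤ ∫ x, f x ∂p + ρ₂ := by
    calc ∫ x, g x ∂p ≤ ∫ x, (f x + ρ₂) ∂p :=
          integral_mono (integrable_of_unit_range p hgm hg0 hghi) ((integrable_of_unit_range p hfm hf0 hf1).add (integrable_const _)) hgf
      _ = ∫ x, f x ∂p + ρ₂ := by
          rw [integral_add (integrable_of_unit_range p hfm hf0 hf1) (integrable_const _), integral_const, smul_eq_mul,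
            probReal_univ, one_mul]
  have step2' := (abs_le.1 step2).2
  have hring : (1 - ρ₂) * ρ₁ + ρ₂ = ρ₁ + ρ₂ - ρ₁ * ρ₂ := by ring
  linarith

/-- ★★ **DISINTEGRATIONS: BASE AND FIBRE RADII COMPOSE LIKE BAD WEIGHTS** (the class-level companion of g2's skew product `core_sigma`): base laws `ρ₁`-close, kernels fibrewise
`ρ₂`-close (`ρ₂ ∈ [0, 1]`) ⇒ the JOINT laws `p ⊗ₘ κ`, `p′ ⊗ₘ κ′` on `X × Y` are `(ρ₁ + ρ₂ − ρ₁ρ₂)`-close on every measurable set.  File 1's independent-block bound is the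
constant-kernel case (`Measure.compProd_const`). [folklore] -/
theorem abs_compProd_real_sub_le_of_tv (hρ₂ : 0 ≤ ρ₂) (hρ₂1 : ρ₂ ≤ 1)
    (h₁ : ∀ S : Set X, MeasurableSet S → |p'.real S - p.real S| ≤ ρ₁)
    (h₂ : ∀ x, ∀ S : Set Y, MeasurableSet S → |(κ' x).real S - (κ x).real S| ≤ ρ₂) {S : Set (X × Y)} (hS : MeasurableSet S) :
    |(p' ⊗ₘ κ').real S - (p ⊗ₘ κ).real S| ≤ ρ₁ + ρ₂ - ρ₁ * ρ₂ :=
  abs_sub_le_iff.2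
    ⟨compProd_real_sub_le_of_tv hρ₂ hρ₂1 h₁ h₂ hS,
      compProd_real_sub_le_of_tv hρ₂ hρ₂1 (fun S hS => by rw [abs_sub_comm]; exact h₁ S hS)
        (fun x S hS => by rw [abs_sub_comm]; exact h₂ x S hS) hS⟩

/-- **DATA PROCESSING FOR JOINT LAWS**: the SAME kernel disintegrating two `ρ₁`-close base laws gives `ρ₁`-close joint laws. [folklore] -/
theorem abs_compProd_real_sub_le_base (h₁ : ∀ S : Set X, MeasurableSet S → |p'.real S - p.real S| ≤ ρ₁) {S : Set (X × Y)}
    (hS : MeasurableSet S) : |(p' ⊗ₘ κ).real S - (p ⊗ₘ κ).real S| ≤ ρ₁ := by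
  have h := abs_compProd_real_sub_le_of_tv (κ := κ) (κ' := κ) (ρ₂ := 0) le_rfl zero_le_one h₁
    (fun x S _ => by rw [sub_self, abs_zero]) hS
  simpa using h

end Disintegration

/-! ## §3 Chains of Markov steps (scale chains) [folklore] -/

section Chain

variable {Ω : ℕ → Type*} [∀ k, MeasurableSpace (Ω k)]
  {μ μ' : ∀ k, Measure (Ω k)} [∀ k, IsProbabilityMeasure (μ k)] [∀ k, IsProbabilityMeasure (μ' k)]
  {κ κ' : ∀ k, Kernel (Ω k) (Ω (k + 1))} [∀ k, IsMarkovKernel (κ k)] [∀ k, IsMarkovKernel (κ' k)]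
  {ρ₀ : ℝ} {σ : ℕ → ℝ}

/-- ★★ **A CHAIN OF MARKOV STEPS COMPOSES LIKE BAD WEIGHTS.**  Two runs' laws `μ_k`, `μ′_k` on spaces `Ω k` driven by Markov steps `μ_{k+1} = κ_k ∘ₘ μ_k`, `μ′_{k+1} = κ′_k ∘ₘ μ′_k`
(recursion as HYPOTHESES), initial laws `ρ₀`-close (`ρ₀ ≤ 1`), step kernels fibrewise `σ_k`-close (`σ_k ∈ [0, 1]`) on every set ⇒ at step `n` the laws are
`(1 − (1 − ρ₀)·∏_{k<n}(1 − σ_k))`-close on every set (induction on §1). [folklore] -/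
theorem abs_chain_real_sub_le_prod (hμ : ∀ k, μ (k + 1) = κ k ∘ₘ μ k) (hμ' : ∀ k, μ' (k + 1) = κ' k ∘ₘ μ' k) (hρ₀ : ρ₀ ≤ 1)
    (h0 : ∀ S : Set (Ω 0), MeasurableSet S → |(μ' 0).real S - (μ 0).real S| ≤ ρ₀) (hσ : ∀ k, 0 ≤ σ k ∧ σ k ≤ 1)
    (hκ : ∀ k x, ∀ S : Set (Ω (k + 1)), MeasurableSet S → |(κ' k x).real S - (κ k x).real S| ≤ σ k) :
    ∀ (n : ℕ) (S : Set (Ω n)), MeasurableSet S →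
      |(μ' n).real S - (μ n).real S| ≤ 1 - (1 - ρ₀) * ∏ k ∈ Finset.range n, (1 - σ k) := by
  intro n
  induction n with
  | zero => intro S hS; simpa using h0 S hS
  | succ n ih =>
    intro S hS
    set R : ℝ := 1 - (1 - ρ₀) * ∏ k ∈ Finset.range n, (1 - σ k) with hR
    have hP1 : ∏ k ∈ Finset.range n, (1 - σ k) ≤ 1 :=
      Finset.prod_le_one (fun k _ => sub_nonneg.2 (hσ k).2) fun k _ => sub_le_self _ (hσ k).1
    have hR1 : R ≤ 1 := by
      have : 0 ≤ (1 - ρ₀) * ∏ k ∈ Finset.range n, (1 - σ k) :=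
        mul_nonneg (sub_nonneg.2 hρ₀) (Finset.prod_nonneg fun k _ => sub_nonneg.2 (hσ k).2)
      linarith
    have key := abs_comp_real_sub_comp_real_le_of_tv (p := μ n) (p' := μ' n) (κ := κ n) (κ' := κ' n) (ρ₁ := R) (hσ n).1 (hσ n).2
      ih (hκ n) hS
    rw [hμ n, hμ' n]
    refine key.trans (le_of_eq ?_)
    rw [Finset.prod_range_succ, hR]; ring

/-- ★ **THE CHAIN RADIUS IS AT MOST THE SUM** `ρ₀ + Σ_{k<n} σ_k` (g2's `one_sub_prod_one_sub_le_sum`, `0 ≤ ρ₀`). [folklore] -/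
theorem abs_chain_real_sub_le_sum (hμ : ∀ k, μ (k + 1) = κ k ∘ₘ μ k) (hμ' : ∀ k, μ' (k + 1) = κ' k ∘ₘ μ' k) (hρ₀ : 0 ≤ ρ₀) (hρ₀1 : ρ₀ ≤ 1)
    (h0 : ∀ S : Set (Ω 0), MeasurableSet S → |(μ' 0).real S - (μ 0).real S| ≤ ρ₀) (hσ : ∀ k, 0 ≤ σ k ∧ σ k ≤ 1)
    (hκ : ∀ k x, ∀ S : Set (Ω (k + 1)), MeasurableSet S → |(κ' k x).real S - (κ k x).real S| ≤ σ k)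
    (n : ℕ) {S : Set (Ω n)} (hS : MeasurableSet S) :
    |(μ' n).real S - (μ n).real S| ≤ ρ₀ + ∑ k ∈ Finset.range n, σ k := by
  refine (abs_chain_real_sub_le_prod hμ hμ' hρ₀1 h0 hσ hκ n S hS).trans ?_
  set P : ℝ := ∏ k ∈ Finset.range n, (1 - σ k) with hP
  have hP1 : P ≤ 1 := Finset.prod_le_one (fun k _ => sub_nonneg.2 (hσ k).2) fun k _ => sub_le_self _ (hσ k).1
  have hsum : 1 - P ≤ ∑ k ∈ Finset.range n, σ k :=
    one_sub_prod_one_sub_le_sum (Finset.range n) (fun k _ => (hσ k).1) (fun k _ => (hσ k).2)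
  have hρP : ρ₀ * P ≤ ρ₀ := mul_le_of_le_one_right hρ₀ hP1
  have e : 1 - (1 - ρ₀) * P = (1 - P) + ρ₀ * P := by ring
  linarith

/-- ★★ **COMMON STEPS NEVER AMPLIFY: NO TRANSPORT FACTOR IN THE TV CURRENCY.**  Along a chain of Markov steps COMMON to both runs (`κ′ = κ`), two initial laws `ρ₀`-close stay
`ρ₀`-close at EVERY step `n` — contrast node U4's `T4CauchySum.delta`, where the log-ratio currency must contract injected discrepancies by `ρⁿ` against `(K+1)^c` growth. [folklore] -/
theorem abs_chain_real_sub_le_initial (hμ : ∀ k, μ (k + 1) = κ k ∘ₘ μ k) (hμ' : ∀ k, μ' (k + 1) = κ k ∘ₘ μ' k) (hρ₀1 : ρ₀ ≤ 1)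
    (h0 : ∀ S : Set (Ω 0), MeasurableSet S → |(μ' 0).real S - (μ 0).real S| ≤ ρ₀) (n : ℕ) {S : Set (Ω n)} (hS : MeasurableSet S) :
    |(μ' n).real S - (μ n).real S| ≤ ρ₀ := by
  have h := abs_chain_real_sub_le_prod (κ := κ) (κ' := κ) (σ := fun _ => 0) hμ hμ' hρ₀1 h0 (fun _ => ⟨le_rfl, zero_le_one⟩)
    (fun k x S _ => by rw [sub_self, abs_zero]) n S hS
  simpa using h

/-- **SUMMABLE INJECTIONS**: with `Σ_k σ_k < ∞` the chain radius is bounded by `ρ₀ + Σ_k σ_k` UNIFORMLY in the number of steps. [folklore] -/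
theorem abs_chain_real_sub_le_tsum (hμ : ∀ k, μ (k + 1) = κ k ∘ₘ μ k) (hμ' : ∀ k, μ' (k + 1) = κ' k ∘ₘ μ' k) (hρ₀ : 0 ≤ ρ₀) (hρ₀1 : ρ₀ ≤ 1)
    (h0 : ∀ S : Set (Ω 0), MeasurableSet S → |(μ' 0).real S - (μ 0).real S| ≤ ρ₀) (hσ : ∀ k, 0 ≤ σ k ∧ σ k ≤ 1) (hσs : Summable σ)
    (hκ : ∀ k x, ∀ S : Set (Ω (k + 1)), MeasurableSet S → |(κ' k x).real S - (κ k x).real S| ≤ σ k)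
    (n : ℕ) {S : Set (Ω n)} (hS : MeasurableSet S) :
    |(μ' n).real S - (μ n).real S| ≤ ρ₀ + ∑' k, σ k :=
  (abs_chain_real_sub_le_sum hμ hμ' hρ₀ hρ₀1 h0 hσ hκ n hS).trans
    (by
      have := hσs.sum_le_tsum (Finset.range n) (fun k _ => (hσ k).1)
      linarith)

end Chain

/-! ## §4 Sharpness of the step bound [folklore] -/

section Sharpness

/-- ★ **§1's CONSTANT IS OPTIMAL.**  On `Bool`: base laws `p = δ_false`, `p′ = (1 − ρ₁)δ_false + ρ₁δ_true`; run A's step is the deterministic copy `x ↦ δ_x`, run B's step jumps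
from `false` to `true` with probability `ρ₂` and keeps `true` (`ρ_b ∈ [0, 1]`).  The kernels are Markov and fibrewise `ρ₂`-close on every set, and the image gap at `{true}` EQUALS
`ρ₁ + ρ₂ − ρ₁ρ₂`.  So no constant below `1 − (1 − ρ₁)(1 − ρ₂)` is a theorem for one Markov step either. [folklore] -/
theorem tv_comp_sharp_toy {ρ₁ ρ₂ : ℝ} (hρ₁ : 0 ≤ ρ₁) (hρ₁1 : ρ₁ ≤ 1) (hρ₂ : 0 ≤ ρ₂) (hρ₂1 : ρ₂ ≤ 1) :
    let p : Measure Bool := Measure.dirac false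
    let p' : Measure Bool := ENNReal.ofReal (1 - ρ₁) • Measure.dirac false + ENNReal.ofReal ρ₁ • Measure.dirac true
    let ν₂ : Measure Bool := ENNReal.ofReal (1 - ρ₂) • Measure.dirac false + ENNReal.ofReal ρ₂ • Measure.dirac true
    let κ : Kernel Bool Bool := ⟨fun x => Measure.dirac x, measurable_of_countable _⟩
    let κ' : Kernel Bool Bool := ⟨fun x => cond x (Measure.dirac true) ν₂, measurable_of_countable _⟩
    IsMarkovKernel κ ∧ IsMarkovKernel κ' ∧ (∀ x, ∀ S : Set Bool, |(κ' x).real S - (κ x).real S| ≤ ρ₂) ∧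
      (κ' ∘ₘ p').real {true} - (κ ∘ₘ p).real {true} = ρ₁ + ρ₂ - ρ₁ * ρ₂ := by
  intro p p' ν₂ κ κ'
  obtain ⟨hP₁, hT₁, hf₁⟩ := twoPoint_toy hρ₁ hρ₁1
  obtain ⟨hP₂, hT₂, hf₂⟩ := twoPoint_toy hρ₂ hρ₂1
  haveI := hP₁; haveI := hP₂
  have hκ : ∀ x, κ x = Measure.dirac x := fun _ => rfl
  have hκ' : ∀ x, κ' x = cond x (Measure.dirac true) ν₂ := fun _ => rfl
  have hMκ : IsMarkovKernel κ := ⟨fun x => by rw [hκ]; infer_instance⟩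
  have hMκ' : IsMarkovKernel κ' := ⟨fun x => by cases x <;> rw [hκ'] <;> simp only [cond_true, cond_false] <;> infer_instance⟩
  haveI := hMκ; haveI := hMκ'
  refine ⟨hMκ, hMκ', fun x S => ?_, ?_⟩
  · cases x
    · rw [hκ', hκ, cond_false]; exact hT₂ S
    · rw [hκ', hκ, cond_true, sub_self, abs_zero]; exact hρ₂
  · rw [comp_real_eq_integral p' κ' (measurableSet_singleton _), comp_real_eq_integral p κ (measurableSet_singleton _),
      integral_fintype Integrable.of_finite, integral_fintype Integrable.of_finite, Fintype.sum_bool, Fintype.sum_bool]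
    simp only [hκ, hκ', cond_true, cond_false, smul_eq_mul]
    have hν₂t : ν₂ {true} = ENNReal.ofReal ρ₂ := by
      show (ENNReal.ofReal (1 - ρ₂) • (Measure.dirac false : Measure Bool) + ENNReal.ofReal ρ₂ • Measure.dirac true) {true} = _
      simp
    have hp't : p' {true} = ENNReal.ofReal ρ₁ := by
      show (ENNReal.ofReal (1 - ρ₁) • (Measure.dirac false : Measure Bool) + ENNReal.ofReal ρ₁ • Measure.dirac true) {true} = _
      simp
    have hp'f : p' {false} = ENNReal.ofReal (1 - ρ₁) := hf₁
    have hpt : p {true} = 0 := by show (Measure.dirac false : Measure Bool) {true} = 0; simp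
    have hpf : p {false} = 1 := by show (Measure.dirac false : Measure Bool) {false} = 1; simp
    have hdtt : (Measure.dirac true : Measure Bool) {true} = 1 := by simp
    simp only [measureReal_def]
    rw [hν₂t, hp't, hp'f, hpt, hpf, hdtt]
    simp only [ENNReal.toReal_ofReal hρ₂, ENNReal.toReal_ofReal hρ₁, ENNReal.toReal_ofReal (sub_nonneg.2 hρ₁1), ENNReal.toReal_zero,
      ENNReal.toReal_one]
    ring

end Sharpness

end Summit.QuantumFields.YangMills.BalabanUVNodes.N19TVKernelChain

end
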